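import Literature.NumberTheory.Sieve.TypeTwoBlock
import Literature.NumberTheory.Sieve.SmoothProfileWeights
import HarnessLib

/-!
# The type I sums `S₂`, `S₃` for smooth cube weights (Hinz 1988, §4, pp. 185–186, smooth form)

Topic `Literature/NumberTheory/Sieve`, sub-namespace `SmoothTypeOne`. In Vaughan's identity for
`∑_{α ∈ A₀(M)} Ω(α) χ(α) Λ((α))` (`NumberFieldVaughan.sum_mul_vonMangoldt_eq_complex` with
`w = Ω·χ`) the terms `S₂`, `S₃` are linear combinations over divisors `𝔞` (`N𝔞 ≤ U²` resp. `≤ U`)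
of the sums `∑_{α ∈ A₀(M), 𝔞 ∣ (α)} Ω(α) χ(α)` (for `S₃` also with the twist `log N((α)/𝔟)`).
For the smooth weight `Ω(α) = ∏_w k(log σ_wα − log M)` these are sums of `χ(a)·F(σa/M)` over ALL
`a ∈ 𝔞` (`sum_cube_dvd_eq_tsum`), which vanish unless `(𝔞, 𝔣) = 1` and are otherwise bounded by
the Poisson-summation estimate `SmoothCoset.charSum_ideal_le` (`m = 3`):
`≤ N𝔣 · E(𝔞𝔣)`, `E(𝔞) = 2^{6d+1} G^d N𝔞 N𝔇² / (√|D| M^d)` (`norm_sum_cube_dvd_le`, `errE_eq`).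
Hinz treats `S₂`, `S₃` with the Pólya–Vinogradov bound over `K` [9]; the smooth weights make
them negligible instead (the main term vanishes since `χ ≠ χ₀`). Main results:

* `norm_S2_le` — `|S₂(χ)| ≤ 2^{6d+1} G^d N𝔇²/√|D| · N𝔣² · (C_I U² log U)·(C_I U²)/M^d`-type bound;
* `norm_S3_le` — the same for `S₃` with the logarithmic twist decomposed place by place
  (`log N((α)/𝔟) = d log M − log N𝔟 + ∑_w (log σ_wα − log M)`, profile `v k(v)` at one place);
* `typeOne_bound` — summed over `Q₁ < N𝔣 ≤ Q` with `(1/φ(𝔣)) ∑*_χ`: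
  `≤ C (G^d + G'^d) U⁴ (log U + log M + 1) Q³ / M^d`.

## References

* J. Hinz, Acta Arith. 51 (1988), §4 pp. 185–186 (`S₂`, `S₃`). [cite: Hinz1988, §4 pp. 185–186]
-/

noncomputable section

open Finset NumberField NumberField.InfinitePlace MeasureTheory
  Literature.NumberTheory.Sieve.NumberFieldLS Literature.NumberTheory.Sieve.BoxPrimes
  Literature.NumberTheory.Sieve.NumberFieldVaughan Literature.NumberTheory.Sieve.MitsuiPNT
  Literature.NumberTheory.LFunctions Literature.NumberTheory.LFunctions.NumberField
  Literature.NumberTheory.Sieve.CastilloEtAl2015 Literature.NumberTheory.Sieve.TypeTwoReparam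
  Literature.NumberTheory.Sieve.TypeTwoCoeff Literature.NumberTheory.Sieve.TypeTwoBlock
  Literature.NumberTheory.Sieve.PrimRed Literature.NumberTheory.Sieve.SmoothCoset
  Literature.NumberTheory.Sieve.SmoothWeights
open scoped Classical FourierTransform

namespace Literature.NumberTheory.Sieve.SmoothTypeOne

variable {K : Type*} [Field K] [NumberField K] [IsTotallyReal K]

local notation "d" => Module.finrank ℚ K
local notation "RP" => {w : InfinitePlace K // IsReal w}

/-! ## The error quantity `E(𝔞)` -/

variable (K) in
/-- `E(𝔞) = 2^{3d+3d+1} G^d (Y^d/(N𝔞 √|D|)) (N𝔞 N𝔇 / Y^d)^{3-1}` — the right-hand side of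
`SmoothCoset.coset_sum` with `m = 3`. [folklore] -/
def errE (G Y : ℝ) (𝔞 : Ideal (𝓞 K)) : ℝ :=
  2 ^ (3 * d + 3 * d + 1) * G ^ d * (Y ^ d / (Ideal.absNorm 𝔞 * Real.sqrt |(discr K : ℝ)|)) *
    ((Ideal.absNorm 𝔞 : ℝ) * Ideal.absNorm (differentIdeal ℤ (𝓞 K)) / Y ^ d) ^ (3 - 1)

omit [IsTotallyReal K] in
/-- `E(𝔞) = 2^{6d+1} G^d N𝔞 N𝔇² / (√|D| Y^d)`. [folklore] -/
theorem errE_eq {G Y : ℝ} (hY : 0 < Y) {𝔞 : Ideal (𝓞 K)} (h𝔞 : 𝔞 ≠ ⊥) :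
    errE K G Y 𝔞 = 2 ^ (6 * d + 1) * G ^ d * Ideal.absNorm (differentIdeal ℤ (𝓞 K)) ^ 2 /
      Real.sqrt |(discr K : ℝ)| * (Ideal.absNorm 𝔞 / Y ^ d) := by
  have hN := absNorm_pos_of_ne_bot h𝔞
  have hD : 0 < Real.sqrt |(discr K : ℝ)| :=
    Real.sqrt_pos.2 (abs_pos.2 (Int.cast_ne_zero.2 (discr_ne_zero K)))
  have hYd : 0 < Y ^ d := pow_pos hY _
  unfold errE
  rw [show 3 * d + 3 * d + 1 = 6 * d + 1 by ring, show (3 : ℕ) - 1 = 2 from rfl]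
  field_simp

omit [IsTotallyReal K] in
/-- `E(𝔞) ≥ 0` for `G ≥ 0`. [folklore] -/
theorem errE_nonneg {G Y : ℝ} (hG : 0 ≤ G) (hY : 0 < Y) (𝔞 : Ideal (𝓞 K)) : 0 ≤ errE K G Y 𝔞 := by
  unfold errE; positivity

omit [IsTotallyReal K] in
/-- `E` is monotone in `G ≥ 0`. [folklore] -/
theorem errE_mono {G G' Y : ℝ} (hG : 0 ≤ G) (hGG' : G ≤ G') (hY : 0 < Y) (𝔞 : Ideal (𝓞 K)) :
    errE K G Y 𝔞 ≤ errE K G' Y 𝔞 := by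
  unfold errE
  gcongr

/-! ## Cube sums over multiples of `𝔞` are sums over the whole ideal -/

/-- The product weight attached to a real profile `k`. [folklore] -/
theorem prodWeight_ne_zero_mem_cubeF (k : ℝ → ℝ) (hhi : ∀ v, 0 ≤ v → k v = 0) {M : ℝ} (hM : 0 < M)
    {a : 𝓞 K} (h : prodWeight K (fun _ : RP => gOfC k) (fun w => remb K (a : K) w / M) ≠ 0) :
    a ∈ cubeF K M := by
  rw [mem_cubeF, mem_box₀_iff_remb]
  intro w
  have hw : gOfC k (remb K (a : K) w / M) ≠ 0 := fun h0 => h (Finset.prod_eq_zero (Finset.mem_univ w) h0)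
  rw [show gOfC k (remb K (a : K) w / M) = (gOf k (remb K (a : K) w / M) : ℂ) from rfl, Ne,
    Complex.ofReal_eq_zero] at hw
  have hpos : 0 < remb K (a : K) w / M := by
    by_contra hle; push Not at hle
    exact hw (by rw [gOf, if_neg (not_lt.2 hle)])
  have hlt : remb K (a : K) w / M < 1 := by
    by_contra hge; push Not at hge
    exact hw (gOf_eq_zero_of_one_le hhi hge)
  rw [div_pos_iff_of_pos_right hM] at hpos
  rw [div_lt_one hM] at hlt
  exact ⟨hpos, hlt.le⟩

/-- On the cube the complexified product weight is `Ω`. [folklore] -/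
theorem prodWeight_eq_weightΩ (k : ℝ → ℝ) {M : ℝ} (hM : 0 < M) {α : 𝓞 K} (hα : α ∈ cubeF K M) :
    prodWeight K (fun _ : RP => gOfC k) (fun w => remb K (α : K) w / M) =
      weightΩ K (fun v => (k v : ℂ)) M α := by
  unfold prodWeight weightΩ
  refine Finset.prod_congr rfl fun w _ => ?_
  obtain ⟨hpos, -⟩ := (mem_box₀_iff_remb.1 (mem_cubeF.1 hα)) w
  show gOfC k (remb K (α : K) w / M) = ((k (Real.log (remb K (α : K) w) - Real.log M) : ℝ) : ℂ)
  rw [show gOfC k (remb K (α : K) w / M) = (gOf k (remb K (α : K) w / M) : ℂ) from rfl,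
    gOf_of_pos k (div_pos hpos hM), Real.log_div hpos.ne' hM.ne']

/-- **`∑_{α ∈ A₀(M), 𝔞 ∣ (α)} Ω(α) f(α) = ∑'_{a ∈ 𝔞} f(a) F(σa/M)`.** [folklore] -/
theorem sum_cube_dvd_eq_tsum (k : ℝ → ℝ) (hhi : ∀ v, 0 ≤ v → k v = 0) {M : ℝ} (hM : 0 < M)
    (𝔞 : Ideal (𝓞 K)) (f : 𝓞 K → ℂ) :
    ∑ α ∈ (cubeF K M).filter (fun α => 𝔞 ∣ Ideal.span {α}), weightΩ K (fun v => (k v : ℂ)) M α * f α =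
      ∑' a : 𝔞, f (a : 𝓞 K) * prodWeight K (fun _ : RP => gOfC k) (fun w => remb K ((a : 𝓞 K) : K) w / M) := by
  rw [tsum_ideal_eq_sum (𝔞 := 𝔞) (F := fun a => f a * prodWeight K (fun _ : RP => gOfC k)
    (fun w => remb K ((a : 𝓞 K) : K) w / M)) (cubeF K M) (fun a _ hne => ?_)]
  · have hfilt : (cubeF K M).filter (fun α => 𝔞 ∣ Ideal.span {α}) = (cubeF K M).filter (· ∈ 𝔞) :=
      Finset.filter_congr fun α _ => Ideal.dvd_span_singleton
    rw [hfilt]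
    refine Finset.sum_congr rfl fun α hα => ?_
    rw [prodWeight_eq_weightΩ k hM (Finset.mem_filter.1 hα).1, mul_comm]
  · exact prodWeight_ne_zero_mem_cubeF k hhi hM fun h0 => hne (by rw [h0, mul_zero])

/-! ## The bound for one ideal -/

omit [NumberField K] [IsTotallyReal K] in
/-- A primitive character to a proper modulus is nontrivial. [folklore] -/
theorem ne_zero_of_isPrimitiveChar {𝔣 : Ideal (𝓞 K)} {χ : AddChar (Additive ((𝓞 K ⧸ 𝔣)ˣ)) ℂ}
    (h : IsPrimitiveChar 𝔣 χ) (h𝔣 : 𝔣 ≠ ⊤) : χ ≠ 0 := by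
  obtain ⟨b, hb, -, hne⟩ := h.exists_ne_one ⊤ le_top (Ne.symm h𝔣)
  rintro rfl
  apply hne
  obtain ⟨u, hu⟩ := hb
  rw [← hu, unitValue_coe,
    Literature.NumberTheory.LFunctions.AbelianDensity.toMulHom_apply, AddChar.zero_apply]

omit [NumberField K] [IsTotallyReal K] in
/-- Elements of an ideal not coprime to `𝔣` are non-units mod `𝔣`. [folklore] -/
theorem not_isUnit_mk_of_mem {𝔞 𝔣 : Ideal (𝓞 K)} (h : ¬ IsCoprime 𝔞 𝔣) {a : 𝓞 K} (ha : a ∈ 𝔞) :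
    ¬ IsUnit (Ideal.Quotient.mk 𝔣 a) := by
  rw [isUnit_mk_iff]
  intro htop
  apply h
  rw [Ideal.isCoprime_iff_sup_eq, eq_top_iff, ← htop]
  exact sup_le_sup_right ((Ideal.span_singleton_le_iff_mem _).2 ha) _

/-- **The type I bound for one ideal**: for a primitive `χ mod 𝔣` (`𝔣 ≠ 0, 1`) and `𝔞 ≠ 0`,
`|∑_{α ∈ A₀(M), 𝔞 ∣ (α)} Ω(α) χ(α)| ≤ [(𝔞,𝔣)=1] · N𝔣 · E(𝔞𝔣)`.
[cite: Hinz1988, §4 p. 185 (S₂)] -/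
theorem norm_sum_cube_dvd_le {k : ℝ → ℝ} (hhi : ∀ v, 0 ≤ v → k v = 0) (hg3 : ContDiff ℝ 3 (gOfC k))
    (hgs : HasCompactSupport (gOfC k)) {G : ℝ} (hG : ∀ τ, ‖𝓕 (gOfC k) τ‖ ≤ G * dec 3 τ)
    {M : ℝ} (hM : 0 < M) {𝔞 𝔣 : Ideal (𝓞 K)} (h𝔞 : 𝔞 ≠ ⊥) (h𝔣 : 𝔣 ≠ ⊥) (h𝔣1 : 𝔣 ≠ ⊤)
    [Fintype (𝓞 K ⧸ 𝔣)] {χ : AddChar (Additive ((𝓞 K ⧸ 𝔣)ˣ)) ℂ} (hχ : IsPrimitiveChar 𝔣 χ) :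
    ‖∑ α ∈ (cubeF K M).filter (fun α => 𝔞 ∣ Ideal.span {α}),
        weightΩ K (fun v => (k v : ℂ)) M α * unitValue χ (Ideal.Quotient.mk 𝔣 α)‖ ≤
      if IsCoprime 𝔞 𝔣 then Ideal.absNorm 𝔣 * errE K G M (𝔞 * 𝔣) else 0 := by
  rw [sum_cube_dvd_eq_tsum k hhi hM 𝔞 (fun a => unitValue χ (Ideal.Quotient.mk 𝔣 a))]
  split_ifs with hcop
  · have h := charSum_ideal_le (K := K) (m := 3) (by norm_num) (g := fun _ : RP => gOfC k)
      (fun _ => hg3.continuous) (fun _ => hgs) (G := G) (fun _ τ => hG τ) h𝔞 h𝔣 hcop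
      (ne_zero_of_isPrimitiveChar hχ h𝔣1) hM
    exact h
  · rw [tsum_congr (fun a => by rw [unitValue_of_not_isUnit χ (not_isUnit_mk_of_mem hcop a.2), zero_mul]),
      tsum_zero, norm_zero]

/-! ## Families of profiles (one profile per place) -/

variable (K) in
/-- The product weight with a profile `k_w` at each place: `∏_w k_w(log σ_wα − log M)`. [folklore] -/
def weightΩfam (kf : RP → ℝ → ℝ) (M : ℝ) (α : 𝓞 K) : ℂ :=
  ∏ w : RP, ((kf w (Real.log (remb K (α : K) w) - Real.log M) : ℝ) : ℂ)

omit [IsTotallyReal K] in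
/-- The constant family is `Ω`. [folklore] -/
theorem weightΩfam_const (k : ℝ → ℝ) (M : ℝ) (α : 𝓞 K) :
    weightΩfam K (fun _ => k) M α = weightΩ K (fun v => (k v : ℂ)) M α := rfl

/-- Family version of `prodWeight_ne_zero_mem_cubeF`. [folklore] -/
theorem prodWeight_fam_ne_zero_mem_cubeF (kf : RP → ℝ → ℝ) (hhi : ∀ w v, 0 ≤ v → kf w v = 0) {M : ℝ}
    (hM : 0 < M) {a : 𝓞 K} (h : prodWeight K (fun w => gOfC (kf w)) (fun w => remb K (a : K) w / M) ≠ 0) :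
    a ∈ cubeF K M := by
  rw [mem_cubeF, mem_box₀_iff_remb]
  intro w
  have hw : gOfC (kf w) (remb K (a : K) w / M) ≠ 0 := fun h0 => h (Finset.prod_eq_zero (Finset.mem_univ w) h0)
  rw [show gOfC (kf w) (remb K (a : K) w / M) = (gOf (kf w) (remb K (a : K) w / M) : ℂ) from rfl, Ne,
    Complex.ofReal_eq_zero] at hw
  have hpos : 0 < remb K (a : K) w / M := by
    by_contra hle; push Not at hle
    exact hw (by rw [gOf, if_neg (not_lt.2 hle)])
  have hlt : remb K (a : K) w / M < 1 := by
    by_contra hge; push Not at hge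
    exact hw (gOf_eq_zero_of_one_le (hhi w) hge)
  rw [div_pos_iff_of_pos_right hM] at hpos
  rw [div_lt_one hM] at hlt
  exact ⟨hpos, hlt.le⟩

/-- Family version of `prodWeight_eq_weightΩ`. [folklore] -/
theorem prodWeight_fam_eq (kf : RP → ℝ → ℝ) {M : ℝ} (hM : 0 < M) {α : 𝓞 K} (hα : α ∈ cubeF K M) :
    prodWeight K (fun w => gOfC (kf w)) (fun w => remb K (α : K) w / M) = weightΩfam K kf M α := by
  unfold prodWeight weightΩfam
  refine Finset.prod_congr rfl fun w _ => ?_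
  obtain ⟨hpos, -⟩ := (mem_box₀_iff_remb.1 (mem_cubeF.1 hα)) w
  show gOfC (kf w) (remb K (α : K) w / M) = ((kf w (Real.log (remb K (α : K) w) - Real.log M) : ℝ) : ℂ)
  rw [show gOfC (kf w) (remb K (α : K) w / M) = (gOf (kf w) (remb K (α : K) w / M) : ℂ) from rfl,
    gOf_of_pos (kf w) (div_pos hpos hM), Real.log_div hpos.ne' hM.ne']

/-- Family version of `sum_cube_dvd_eq_tsum`. [folklore] -/
theorem sum_cube_dvd_fam_eq_tsum (kf : RP → ℝ → ℝ) (hhi : ∀ w v, 0 ≤ v → kf w v = 0) {M : ℝ} (hM : 0 < M)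
    (𝔞 : Ideal (𝓞 K)) (f : 𝓞 K → ℂ) :
    ∑ α ∈ (cubeF K M).filter (fun α => 𝔞 ∣ Ideal.span {α}), weightΩfam K kf M α * f α =
      ∑' a : 𝔞, f (a : 𝓞 K) * prodWeight K (fun w => gOfC (kf w)) (fun w => remb K ((a : 𝓞 K) : K) w / M) := by
  rw [tsum_ideal_eq_sum (𝔞 := 𝔞) (F := fun a => f a * prodWeight K (fun w => gOfC (kf w))
    (fun w => remb K ((a : 𝓞 K) : K) w / M)) (cubeF K M) (fun a _ hne => ?_)]
  · have hfilt : (cubeF K M).filter (fun α => 𝔞 ∣ Ideal.span {α}) = (cubeF K M).filter (· ∈ 𝔞) :=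
      Finset.filter_congr fun α _ => Ideal.dvd_span_singleton
    rw [hfilt]
    refine Finset.sum_congr rfl fun α hα => ?_
    rw [prodWeight_fam_eq kf hM (Finset.mem_filter.1 hα).1, mul_comm]
  · exact prodWeight_fam_ne_zero_mem_cubeF kf hhi hM fun h0 => hne (by rw [h0, mul_zero])

/-- **Family version of the type I bound for one ideal.** [cite: Hinz1988, §4 p. 185 (S₂)] -/
theorem norm_sum_cube_dvd_fam_le {kf : RP → ℝ → ℝ} (hhi : ∀ w v, 0 ≤ v → kf w v = 0)
    (hg3 : ∀ w, ContDiff ℝ 3 (gOfC (kf w))) (hgs : ∀ w, HasCompactSupport (gOfC (kf w))) {G : ℝ}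
    (hG : ∀ w τ, ‖𝓕 (gOfC (kf w)) τ‖ ≤ G * dec 3 τ)
    {M : ℝ} (hM : 0 < M) {𝔞 𝔣 : Ideal (𝓞 K)} (h𝔞 : 𝔞 ≠ ⊥) (h𝔣 : 𝔣 ≠ ⊥) (h𝔣1 : 𝔣 ≠ ⊤)
    [Fintype (𝓞 K ⧸ 𝔣)] {χ : AddChar (Additive ((𝓞 K ⧸ 𝔣)ˣ)) ℂ} (hχ : IsPrimitiveChar 𝔣 χ) :
    ‖∑ α ∈ (cubeF K M).filter (fun α => 𝔞 ∣ Ideal.span {α}),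
        weightΩfam K kf M α * unitValue χ (Ideal.Quotient.mk 𝔣 α)‖ ≤
      if IsCoprime 𝔞 𝔣 then Ideal.absNorm 𝔣 * errE K G M (𝔞 * 𝔣) else 0 := by
  rw [sum_cube_dvd_fam_eq_tsum kf hhi hM 𝔞 (fun a => unitValue χ (Ideal.Quotient.mk 𝔣 a))]
  split_ifs with hcop
  · exact charSum_ideal_le (K := K) (m := 3) (by norm_num) (g := fun w => gOfC (kf w))
      (fun w => (hg3 w).continuous) hgs (G := G) hG h𝔞 h𝔣 hcop (ne_zero_of_isPrimitiveChar hχ h𝔣1) hM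
  · rw [tsum_congr (fun a => by rw [unitValue_of_not_isUnit χ (not_isUnit_mk_of_mem hcop a.2), zero_mul]),
      tsum_zero, norm_zero]

/-! ## `S₂` -/

variable (K) in
/-- `S₂(χ) = ∑_{N𝔟≤U} ∑_{N𝔠≤U} Λ(𝔟) μ(𝔠) ∑_{α ∈ A₀(M), 𝔟𝔠 ∣ (α)} Ω(α) χ(α)`.
[cite: Hinz1988, §4 p. 185 (S₂)] -/
def S2 {𝔣 : Ideal (𝓞 K)} (χ : AddChar (Additive ((𝓞 K ⧸ 𝔣)ˣ)) ℂ) (k : ℝ → ℝ) (M U : ℝ) : ℂ :=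
  ∑ 𝔟 ∈ idealsLE K U, ∑ 𝔠 ∈ idealsLE K U, (idealVonMangoldt 𝔟 : ℂ) * (idealMoebius 𝔠 : ℂ) *
    ∑ α ∈ (cubeF K M).filter (fun α => 𝔟 * 𝔠 ∣ Ideal.span {α}),
      weightΩ K (fun v => (k v : ℂ)) M α * unitValue χ (Ideal.Quotient.mk 𝔣 α)

variable (K) in
/-- The field constant `c_K = 2^{6d+1} N𝔇² / √|D|` of `errE_eq`. [folklore] -/
def cErr : ℝ := 2 ^ (6 * d + 1) * Ideal.absNorm (differentIdeal ℤ (𝓞 K)) ^ 2 / Real.sqrt |(discr K : ℝ)|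

omit [IsTotallyReal K] in
/-- `c_K > 0`. [folklore] -/
theorem cErr_pos : 0 < cErr K := by
  unfold cErr
  have hD : 0 < Real.sqrt |(discr K : ℝ)| :=
    Real.sqrt_pos.2 (abs_pos.2 (Int.cast_ne_zero.2 (discr_ne_zero K)))
  have hN : (0 : ℝ) < Ideal.absNorm (differentIdeal ℤ (𝓞 K)) :=
    lt_of_lt_of_le one_pos (by exact_mod_cast one_le_absNorm_differentIdeal (K := K))
  positivity

omit [IsTotallyReal K] in
/-- `N𝔣 · E(𝔞𝔣) = c_K G^d N𝔞 N𝔣² / M^d`. [folklore] -/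
theorem absNorm_mul_errE_mul {G M : ℝ} (hM : 0 < M) {𝔞 𝔣 : Ideal (𝓞 K)} (h𝔞 : 𝔞 ≠ ⊥) (h𝔣 : 𝔣 ≠ ⊥) :
    Ideal.absNorm 𝔣 * errE K G M (𝔞 * 𝔣) = cErr K * G ^ d * (Ideal.absNorm 𝔞 * Ideal.absNorm 𝔣 ^ 2) / M ^ d := by
  rw [errE_eq hM (mul_ne_zero h𝔞 h𝔣), map_mul, Nat.cast_mul, cErr]
  ring

/-- **The bound for `S₂`.** [cite: Hinz1988, §4 p. 185 (S₂)] -/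
theorem norm_S2_le {k : ℝ → ℝ} (hhi : ∀ v, 0 ≤ v → k v = 0) (hg3 : ContDiff ℝ 3 (gOfC k))
    (hgs : HasCompactSupport (gOfC k)) {G : ℝ} (hG0 : 0 ≤ G) (hG : ∀ τ, ‖𝓕 (gOfC k) τ‖ ≤ G * dec 3 τ)
    {M : ℝ} (hM : 0 < M) (U : ℝ) {𝔣 : Ideal (𝓞 K)} (h𝔣 : 𝔣 ≠ ⊥) (h𝔣1 : 𝔣 ≠ ⊤) [Fintype (𝓞 K ⧸ 𝔣)]
    {χ : AddChar (Additive ((𝓞 K ⧸ 𝔣)ˣ)) ℂ} (hχ : IsPrimitiveChar 𝔣 χ) :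
    ‖S2 K χ k M U‖ ≤ cErr K * G ^ d * Ideal.absNorm 𝔣 ^ 2 / M ^ d *
      ((∑ 𝔟 ∈ idealsLE K U, idealVonMangoldt 𝔟 * Ideal.absNorm 𝔟) * ∑ 𝔠 ∈ idealsLE K U, (Ideal.absNorm 𝔠 : ℝ)) := by
  unfold S2
  have hterm : ∀ 𝔟 ∈ idealsLE K U, ∀ 𝔠 ∈ idealsLE K U,
      ‖(idealVonMangoldt 𝔟 : ℂ) * (idealMoebius 𝔠 : ℂ) *
        ∑ α ∈ (cubeF K M).filter (fun α => 𝔟 * 𝔠 ∣ Ideal.span {α}),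
          weightΩ K (fun v => (k v : ℂ)) M α * unitValue χ (Ideal.Quotient.mk 𝔣 α)‖ ≤
      cErr K * G ^ d * Ideal.absNorm 𝔣 ^ 2 / M ^ d * (idealVonMangoldt 𝔟 * Ideal.absNorm 𝔟 * Ideal.absNorm 𝔠) := by
    intro 𝔟 h𝔟 𝔠 h𝔠
    have h𝔟0 := (mem_idealsLE.1 h𝔟).1
    have h𝔠0 := (mem_idealsLE.1 h𝔠).1
    have hΛ := idealVonMangoldt_nonneg 𝔟
    have hin := norm_sum_cube_dvd_le hhi hg3 hgs hG hM (mul_ne_zero h𝔟0 h𝔠0) h𝔣 h𝔣1 hχ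
    have hin' : ‖∑ α ∈ (cubeF K M).filter (fun α => 𝔟 * 𝔠 ∣ Ideal.span {α}),
        weightΩ K (fun v => (k v : ℂ)) M α * unitValue χ (Ideal.Quotient.mk 𝔣 α)‖ ≤
        cErr K * G ^ d * Ideal.absNorm 𝔣 ^ 2 / M ^ d * (Ideal.absNorm 𝔟 * Ideal.absNorm 𝔠) := by
      refine hin.trans ?_
      split_ifs with hcop
      · rw [absNorm_mul_errE_mul hM (mul_ne_zero h𝔟0 h𝔠0) h𝔣, map_mul, Nat.cast_mul]
        exact le_of_eq (by ring)
      · have := cErr_pos (K := K); positivity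
    rw [norm_mul, norm_mul, Complex.norm_real, Real.norm_eq_abs, abs_of_nonneg hΛ]
    have hμ : ‖(idealMoebius 𝔠 : ℂ)‖ ≤ 1 := by
      rw [Complex.norm_intCast]; exact_mod_cast abs_idealMoebius_le_one 𝔠
    calc idealVonMangoldt 𝔟 * ‖(idealMoebius 𝔠 : ℂ)‖ *
          ‖∑ α ∈ (cubeF K M).filter (fun α => 𝔟 * 𝔠 ∣ Ideal.span {α}),
            weightΩ K (fun v => (k v : ℂ)) M α * unitValue χ (Ideal.Quotient.mk 𝔣 α)‖
        ≤ idealVonMangoldt 𝔟 * 1 * (cErr K * G ^ d * Ideal.absNorm 𝔣 ^ 2 / M ^ d * (Ideal.absNorm 𝔟 * Ideal.absNorm 𝔠)) :=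
          mul_le_mul (mul_le_mul_of_nonneg_left hμ hΛ) hin' (norm_nonneg _) (by positivity)
      _ = _ := by ring
  calc ‖∑ 𝔟 ∈ idealsLE K U, ∑ 𝔠 ∈ idealsLE K U, (idealVonMangoldt 𝔟 : ℂ) * (idealMoebius 𝔠 : ℂ) *
        ∑ α ∈ (cubeF K M).filter (fun α => 𝔟 * 𝔠 ∣ Ideal.span {α}),
          weightΩ K (fun v => (k v : ℂ)) M α * unitValue χ (Ideal.Quotient.mk 𝔣 α)‖
      ≤ ∑ 𝔟 ∈ idealsLE K U, ∑ 𝔠 ∈ idealsLE K U,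
          cErr K * G ^ d * Ideal.absNorm 𝔣 ^ 2 / M ^ d * (idealVonMangoldt 𝔟 * Ideal.absNorm 𝔟 * Ideal.absNorm 𝔠) := by
        refine (norm_sum_le _ _).trans (Finset.sum_le_sum fun 𝔟 h𝔟 => ?_)
        exact (norm_sum_le _ _).trans (Finset.sum_le_sum fun 𝔠 h𝔠 => hterm 𝔟 h𝔟 𝔠 h𝔠)
    _ = _ := by
        rw [Finset.sum_mul_sum, Finset.mul_sum]
        refine Finset.sum_congr rfl fun 𝔟 _ => ?_
        rw [Finset.mul_sum]

/-! ## `S₃`: the logarithmic twist, place by place -/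

/-- The logarithmic coordinates relative to `M`: `ℓ_w(α) = log σ_wα − log M`. [folklore] -/
def ell (M : ℝ) (α : 𝓞 K) (w : RP) : ℝ := Real.log (remb K (α : K) w) - Real.log M

/-- `log N((α)) = ∑_w log σ_w α` for totally positive `α`. [folklore] -/
theorem log_absNorm_span_eq_sum {α : 𝓞 K} (hα : NumberField.IsTotPos K (α : K)) :
    Real.log (Ideal.absNorm (Ideal.span {α}) : ℝ) = ∑ w : RP, Real.log (remb K (α : K) w) := by
  have h1 := abs_norm_eq_prod_abs_remb (K := K) (α : K)
  have h2 : (Ideal.absNorm (Ideal.span {α}) : ℝ) = |(Algebra.norm ℚ (α : K) : ℝ)| := by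
    rw [Ideal.absNorm_span_singleton, ← Algebra.coe_norm_int α, Rat.cast_intCast, Nat.cast_natAbs, Int.cast_abs]
  rw [h2, h1, Real.log_prod (s := Finset.univ) (f := fun w => |remb K (α : K) w|)
    (fun w _ => (abs_pos.2 (remb_pos_of_isTotPos hα w).ne').ne')]
  exact Finset.sum_congr rfl fun w _ => by rw [abs_of_pos (remb_pos_of_isTotPos hα w)]

/-- The twisted family at the place `w₀`: profile `v k(v)` at `w₀`, `k` elsewhere. [folklore] -/
def twistFam (k : ℝ → ℝ) (w₀ : RP) : RP → ℝ → ℝ := Function.update (fun _ => k) w₀ fun v => v * k v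

omit [IsTotallyReal K] in
/-- `Ω^{(w₀)}(α) = ℓ_{w₀}(α) · Ω(α)`. [folklore] -/
theorem weightΩfam_twistFam (k : ℝ → ℝ) (M : ℝ) (α : 𝓞 K) (w₀ : RP) :
    weightΩfam K (twistFam k w₀) M α = (ell M α w₀ : ℂ) * weightΩ K (fun v => (k v : ℂ)) M α := by
  unfold weightΩfam weightΩ twistFam
  have hupd : (fun w : RP => ((Function.update (fun _ : RP => k) w₀ (fun v => v * k v) w
      (Real.log (remb K (α : K) w) - Real.log M) : ℝ) : ℂ)) =
      Function.update (fun w : RP => ((k (Real.log (remb K (α : K) w) - Real.log M) : ℝ) : ℂ)) w₀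
        (((ell M α w₀ * k (ell M α w₀) : ℝ) : ℂ)) := by
    funext w
    by_cases hw : w = w₀
    · subst hw; simp [ell]
    · rw [Function.update_of_ne hw, Function.update_of_ne hw]
  rw [hupd, Finset.prod_update_of_mem (Finset.mem_univ w₀), ← Finset.mul_prod_erase _ _ (Finset.mem_univ w₀),
    Finset.sdiff_singleton_eq_erase]
  push_cast
  simp only [ell]
  ring

/-- **The logarithmic twist decomposed**: for `α ∈ A₀(M)` and `𝔟 ∣ (α)`, `𝔟 ≠ 0`,
`Ω(α) log N((α)/𝔟) = (d log M − log N𝔟) Ω(α) + ∑_{w₀} Ω^{(w₀)}(α)`. [cite: Hinz1988, §4 (4.4)] -/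
theorem weightΩ_mul_log_cofactor {k : ℝ → ℝ} {M : ℝ} {α : 𝓞 K} (hα : α ∈ cubeF K M)
    {𝔟 : Ideal (𝓞 K)} (h𝔟 : 𝔟 ≠ ⊥) (hdvd : 𝔟 ∣ Ideal.span {α}) :
    weightΩ K (fun v => (k v : ℂ)) M α * (Real.log (Ideal.absNorm (cofactor (Ideal.span {α}) 𝔟)) : ℂ) =
      ((d * Real.log M - Real.log (Ideal.absNorm 𝔟) : ℝ) : ℂ) * weightΩ K (fun v => (k v : ℂ)) M α +
        ∑ w₀ : RP, weightΩfam K (twistFam k w₀) M α := by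
  have hαpos := isTotPos_of_mem_cubeF hα
  have hα0 : Ideal.span {α} ≠ ⊥ := by
    rw [Ne, Ideal.span_singleton_eq_bot]; exact ne_zero_of_mem_box₀ (mem_cubeF.1 hα)
  have hN𝔟 := absNorm_pos_of_ne_bot h𝔟
  have hNc := absNorm_pos_of_ne_bot (cofactor_ne_bot hα0 hdvd)
  -- `log N(cof) = log N((α)) − log N𝔟`
  have hlog : Real.log (Ideal.absNorm (cofactor (Ideal.span {α}) 𝔟) : ℝ) =
      Real.log (Ideal.absNorm (Ideal.span {α}) : ℝ) - Real.log (Ideal.absNorm 𝔟) := by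
    have hmul : (Ideal.absNorm (Ideal.span {α}) : ℝ) = Ideal.absNorm 𝔟 * Ideal.absNorm (cofactor (Ideal.span {α}) 𝔟) := by
      conv_lhs => rw [← mul_cofactor hdvd]
      rw [map_mul, Nat.cast_mul]
    rw [hmul, Real.log_mul hN𝔟.ne' hNc.ne']; ring
  -- `log N((α)) = ∑ ℓ_w + d log M`
  have hsum : Real.log (Ideal.absNorm (Ideal.span {α}) : ℝ) = (∑ w : RP, ell M α w) + d * Real.log M := by
    rw [log_absNorm_span_eq_sum hαpos]
    simp only [ell, Finset.sum_sub_distrib, Finset.sum_const, Finset.card_univ, SmoothCoset.card_RP_eq,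
      nsmul_eq_mul]
    ring
  rw [hlog, hsum]
  simp_rw [weightΩfam_twistFam]
  rw [← Finset.sum_mul]
  push_cast
  ring

variable (K) in
/-- `S₃(χ) = ∑_{N𝔟≤U} μ(𝔟) ∑_{α ∈ A₀(M), 𝔟 ∣ (α)} Ω(α) χ(α) log N((α)/𝔟)`. [cite: Hinz1988, §4 (4.4)] -/
def S3 {𝔣 : Ideal (𝓞 K)} (χ : AddChar (Additive ((𝓞 K ⧸ 𝔣)ˣ)) ℂ) (k : ℝ → ℝ) (M U : ℝ) : ℂ :=
  ∑ 𝔟 ∈ idealsLE K U, (idealMoebius 𝔟 : ℂ) *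
    ∑ α ∈ (cubeF K M).filter (fun α => 𝔟 ∣ Ideal.span {α}),
      weightΩ K (fun v => (k v : ℂ)) M α * unitValue χ (Ideal.Quotient.mk 𝔣 α) *
        (Real.log (Ideal.absNorm (cofactor (Ideal.span {α}) 𝔟)) : ℂ)

/-- **The bound for `S₃`** (with one constant `G` bounding `‖k̂_w‖` for the profile and its twist).
[cite: Hinz1988, §4 (4.4)] -/
theorem norm_S3_le {k : ℝ → ℝ} (hhi : ∀ v, 0 ≤ v → k v = 0) (hg3 : ContDiff ℝ 3 (gOfC k))
    (hgs : HasCompactSupport (gOfC k)) (hg3' : ContDiff ℝ 3 (gOfC fun v => v * k v))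
    (hgs' : HasCompactSupport (gOfC fun v => v * k v)) {G : ℝ} (hG0 : 0 ≤ G)
    (hG : ∀ τ, ‖𝓕 (gOfC k) τ‖ ≤ G * dec 3 τ) (hG' : ∀ τ, ‖𝓕 (gOfC fun v => v * k v) τ‖ ≤ G * dec 3 τ)
    {M : ℝ} (hM : 1 ≤ M) {U : ℝ} (hU : 1 ≤ U) {𝔣 : Ideal (𝓞 K)} (h𝔣 : 𝔣 ≠ ⊥) (h𝔣1 : 𝔣 ≠ ⊤)
    [Fintype (𝓞 K ⧸ 𝔣)] {χ : AddChar (Additive ((𝓞 K ⧸ 𝔣)ˣ)) ℂ} (hχ : IsPrimitiveChar 𝔣 χ) :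
    ‖S3 K χ k M U‖ ≤ cErr K * G ^ d * Ideal.absNorm 𝔣 ^ 2 / M ^ d *
      ((d * Real.log M + Real.log U + d) * ∑ 𝔟 ∈ idealsLE K U, (Ideal.absNorm 𝔟 : ℝ)) := by
  have hM0 : 0 < M := by linarith
  have hlogM : 0 ≤ Real.log M := Real.log_nonneg hM
  have hlogU : 0 ≤ Real.log U := Real.log_nonneg hU
  have hcE := cErr_pos (K := K)
  -- the family hypotheses
  have hfam : ∀ w₀ : RP, (∀ w v, 0 ≤ v → twistFam k w₀ w v = 0) ∧ (∀ w, ContDiff ℝ 3 (gOfC (twistFam k w₀ w))) ∧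
      (∀ w, HasCompactSupport (gOfC (twistFam k w₀ w))) ∧ ∀ w τ, ‖𝓕 (gOfC (twistFam k w₀ w)) τ‖ ≤ G * dec 3 τ := by
    intro w₀
    refine ⟨fun w v hv => ?_, fun w => ?_, fun w => ?_, fun w τ => ?_⟩ <;> by_cases hw : w = w₀
    · subst hw; simp [twistFam, hhi v hv]
    · rw [twistFam, Function.update_of_ne hw]; exact hhi v hv
    · subst hw; simpa [twistFam] using hg3'
    · rw [twistFam, Function.update_of_ne hw]; exact hg3
    · subst hw; simpa [twistFam] using hgs'
    · rw [twistFam, Function.update_of_ne hw]; exact hgs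
    · subst hw; simpa [twistFam] using hG' τ
    · rw [twistFam, Function.update_of_ne hw]; exact hG τ
  unfold S3
  -- termwise
  have hterm : ∀ 𝔟 ∈ idealsLE K U, ‖(idealMoebius 𝔟 : ℂ) *
      ∑ α ∈ (cubeF K M).filter (fun α => 𝔟 ∣ Ideal.span {α}),
        weightΩ K (fun v => (k v : ℂ)) M α * unitValue χ (Ideal.Quotient.mk 𝔣 α) *
          (Real.log (Ideal.absNorm (cofactor (Ideal.span {α}) 𝔟)) : ℂ)‖ ≤
      cErr K * G ^ d * Ideal.absNorm 𝔣 ^ 2 / M ^ d * ((d * Real.log M + Real.log U + d) * Ideal.absNorm 𝔟) := by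
    intro 𝔟 h𝔟
    obtain ⟨h𝔟0, h𝔟U⟩ := mem_idealsLE.1 h𝔟
    have hN𝔟 := absNorm_pos_of_ne_bot h𝔟0
    have hN𝔟1 : (1 : ℝ) ≤ Ideal.absNorm 𝔟 := by
      exact_mod_cast Nat.one_le_iff_ne_zero.2 (by rw [Ne, Ideal.absNorm_eq_zero_iff]; exact h𝔟0)
    have hlog𝔟 : 0 ≤ Real.log (Ideal.absNorm 𝔟 : ℝ) := Real.log_nonneg hN𝔟1
    have hlog𝔟U : Real.log (Ideal.absNorm 𝔟 : ℝ) ≤ Real.log U := Real.log_le_log hN𝔟 h𝔟U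
    -- decompose the inner sum
    have hdec : ∑ α ∈ (cubeF K M).filter (fun α => 𝔟 ∣ Ideal.span {α}),
        weightΩ K (fun v => (k v : ℂ)) M α * unitValue χ (Ideal.Quotient.mk 𝔣 α) *
          (Real.log (Ideal.absNorm (cofactor (Ideal.span {α}) 𝔟)) : ℂ) =
        ((d * Real.log M - Real.log (Ideal.absNorm 𝔟) : ℝ) : ℂ) *
          (∑ α ∈ (cubeF K M).filter (fun α => 𝔟 ∣ Ideal.span {α}),
            weightΩ K (fun v => (k v : ℂ)) M α * unitValue χ (Ideal.Quotient.mk 𝔣 α)) +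
        ∑ w₀ : RP, ∑ α ∈ (cubeF K M).filter (fun α => 𝔟 ∣ Ideal.span {α}),
            weightΩfam K (twistFam k w₀) M α * unitValue χ (Ideal.Quotient.mk 𝔣 α) := by
      rw [Finset.mul_sum, Finset.sum_comm, ← Finset.sum_add_distrib]
      refine Finset.sum_congr rfl fun α hα => ?_
      obtain ⟨hαc, hdvd⟩ := Finset.mem_filter.1 hα
      have := weightΩ_mul_log_cofactor (k := k) (M := M) hαc h𝔟0 hdvd
      rw [mul_right_comm, this, add_mul, Finset.sum_mul]
      ring
    have hb1 := norm_sum_cube_dvd_le hhi hg3 hgs hG hM0 h𝔟0 h𝔣 h𝔣1 hχ (𝔞 := 𝔟)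
    have hb2 : ∀ w₀ : RP, ‖∑ α ∈ (cubeF K M).filter (fun α => 𝔟 ∣ Ideal.span {α}),
        weightΩfam K (twistFam k w₀) M α * unitValue χ (Ideal.Quotient.mk 𝔣 α)‖ ≤
        if IsCoprime 𝔟 𝔣 then Ideal.absNorm 𝔣 * errE K G M (𝔟 * 𝔣) else 0 := fun w₀ =>
      norm_sum_cube_dvd_fam_le (hfam w₀).1 (hfam w₀).2.1 (hfam w₀).2.2.1 (hfam w₀).2.2.2 hM0 h𝔟0 h𝔣 h𝔣1 hχ
    -- the common bound `B = c G^d N𝔟 N𝔣²/M^d`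
    obtain ⟨B, hB⟩ : ∃ B : ℝ, B = cErr K * G ^ d * (Ideal.absNorm 𝔟 * Ideal.absNorm 𝔣 ^ 2) / M ^ d := ⟨_, rfl⟩
    have hB0 : 0 ≤ B := by rw [hB]; positivity
    have hite : (if IsCoprime 𝔟 𝔣 then Ideal.absNorm 𝔣 * errE K G M (𝔟 * 𝔣) else 0) ≤ B := by
      split_ifs
      · rw [absNorm_mul_errE_mul hM0 h𝔟0 h𝔣, hB]
      · exact hB0
    have hμ : ‖(idealMoebius 𝔟 : ℂ)‖ ≤ 1 := by
      rw [Complex.norm_intCast]; exact_mod_cast abs_idealMoebius_le_one 𝔟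
    rw [norm_mul, hdec]
    have hcoef : ‖((d * Real.log M - Real.log (Ideal.absNorm 𝔟) : ℝ) : ℂ)‖ ≤ d * Real.log M + Real.log U := by
      rw [Complex.norm_real, Real.norm_eq_abs]
      refine abs_le.2 ⟨?_, ?_⟩ <;> nlinarith [hlog𝔟, hlog𝔟U, hlogM, (Nat.cast_nonneg d : (0:ℝ) ≤ d)]
    have hin : ‖((d * Real.log M - Real.log (Ideal.absNorm 𝔟) : ℝ) : ℂ) *
        (∑ α ∈ (cubeF K M).filter (fun α => 𝔟 ∣ Ideal.span {α}),
          weightΩ K (fun v => (k v : ℂ)) M α * unitValue χ (Ideal.Quotient.mk 𝔣 α)) +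
        ∑ w₀ : RP, ∑ α ∈ (cubeF K M).filter (fun α => 𝔟 ∣ Ideal.span {α}),
          weightΩfam K (twistFam k w₀) M α * unitValue χ (Ideal.Quotient.mk 𝔣 α)‖ ≤
        (d * Real.log M + Real.log U) * B + d * B := by
      refine (norm_add_le _ _).trans (add_le_add ?_ ?_)
      · rw [norm_mul]
        exact mul_le_mul hcoef (hb1.trans hite) (norm_nonneg _) (by positivity)
      · refine (norm_sum_le _ _).trans ?_
        calc ∑ w₀ : RP, ‖∑ α ∈ (cubeF K M).filter (fun α => 𝔟 ∣ Ideal.span {α}),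
              weightΩfam K (twistFam k w₀) M α * unitValue χ (Ideal.Quotient.mk 𝔣 α)‖
            ≤ ∑ _w₀ : RP, B := Finset.sum_le_sum fun w₀ _ => (hb2 w₀).trans hite
          _ = d * B := by rw [Finset.sum_const, Finset.card_univ, SmoothCoset.card_RP_eq, nsmul_eq_mul]
    calc ‖(idealMoebius 𝔟 : ℂ)‖ * ‖((d * Real.log M - Real.log (Ideal.absNorm 𝔟) : ℝ) : ℂ) *
          (∑ α ∈ (cubeF K M).filter (fun α => 𝔟 ∣ Ideal.span {α}),
            weightΩ K (fun v => (k v : ℂ)) M α * unitValue χ (Ideal.Quotient.mk 𝔣 α)) +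
          ∑ w₀ : RP, ∑ α ∈ (cubeF K M).filter (fun α => 𝔟 ∣ Ideal.span {α}),
            weightΩfam K (twistFam k w₀) M α * unitValue χ (Ideal.Quotient.mk 𝔣 α)‖
        ≤ 1 * ((d * Real.log M + Real.log U) * B + d * B) := mul_le_mul hμ hin (norm_nonneg _) zero_le_one
      _ = cErr K * G ^ d * Ideal.absNorm 𝔣 ^ 2 / M ^ d * ((d * Real.log M + Real.log U + d) * Ideal.absNorm 𝔟) := by
          rw [hB]; ring
  calc ‖∑ 𝔟 ∈ idealsLE K U, (idealMoebius 𝔟 : ℂ) *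
        ∑ α ∈ (cubeF K M).filter (fun α => 𝔟 ∣ Ideal.span {α}),
          weightΩ K (fun v => (k v : ℂ)) M α * unitValue χ (Ideal.Quotient.mk 𝔣 α) *
            (Real.log (Ideal.absNorm (cofactor (Ideal.span {α}) 𝔟)) : ℂ)‖
      ≤ ∑ 𝔟 ∈ idealsLE K U, cErr K * G ^ d * Ideal.absNorm 𝔣 ^ 2 / M ^ d *
          ((d * Real.log M + Real.log U + d) * Ideal.absNorm 𝔟) := (norm_sum_le _ _).trans (Finset.sum_le_sum hterm)
    _ = _ := by rw [Finset.mul_sum, Finset.mul_sum]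

/-! ## The type I bound summed over the moduli -/

omit [IsTotallyReal K] in
/-- `#(primitive characters mod 𝔣) ≤ φ(𝔣)`. [folklore] -/
theorem card_primChars_le {𝔣 : Ideal (𝓞 K)} (h𝔣 : 𝔣 ≠ ⊥) :
    ((primChars K 𝔣).card : ℝ) ≤ Nat.card ((𝓞 K ⧸ 𝔣)ˣ) := by
  haveI : Finite (𝓞 K ⧸ 𝔣) := Ideal.finiteQuotientOfFreeOfNeBot 𝔣 h𝔣
  letI : Fintype (𝓞 K ⧸ 𝔣) := Fintype.ofFinite _
  rw [primChars, dif_neg h𝔣, Nat.card_eq_fintype_card]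
  have h1 := Finset.card_filter_le (Finset.univ : Finset (AddChar (Additive ((𝓞 K ⧸ 𝔣)ˣ)) ℂ)) (IsPrimitiveChar 𝔣)
  rw [Finset.card_univ] at h1
  have h2 : Fintype.card (AddChar (Additive ((𝓞 K ⧸ 𝔣)ˣ)) ℂ) ≤ Fintype.card (Additive ((𝓞 K ⧸ 𝔣)ˣ)) :=
    AddChar.card_addChar_le _ _
  rw [Fintype.card_congr (Additive.ofMul (α := (𝓞 K ⧸ 𝔣)ˣ)).symm] at h2
  exact_mod_cast (h1.trans h2).trans (le_of_eq (by convert rfl))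

omit [IsTotallyReal K] in
/-- Ideals of norm `> 1` are proper. [folklore] -/
theorem ne_top_of_one_lt_absNorm {𝔣 : Ideal (𝓞 K)} (h : (1 : ℝ) < Ideal.absNorm 𝔣) : 𝔣 ≠ ⊤ := by
  rintro rfl; rw [Ideal.absNorm_top, Nat.cast_one] at h; exact lt_irrefl _ h

/-- **The type I sums averaged over the primitive characters of the moduli `Q₁ < N𝔣 ≤ Q`.**
[cite: Hinz1988, §4 pp. 185–186] -/
theorem typeOne_bound {k : ℝ → ℝ} (hhi : ∀ v, 0 ≤ v → k v = 0) (hg3 : ContDiff ℝ 3 (gOfC k))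
    (hgs : HasCompactSupport (gOfC k)) (hg3' : ContDiff ℝ 3 (gOfC fun v => v * k v))
    (hgs' : HasCompactSupport (gOfC fun v => v * k v)) {G : ℝ} (hG0 : 0 ≤ G)
    (hG : ∀ τ, ‖𝓕 (gOfC k) τ‖ ≤ G * dec 3 τ) (hG' : ∀ τ, ‖𝓕 (gOfC fun v => v * k v) τ‖ ≤ G * dec 3 τ)
    {M : ℝ} (hM : 1 ≤ M) {U : ℝ} (hU : 1 ≤ U) {Q₁ : ℝ} (hQ₁ : 1 ≤ Q₁) (Q : ℝ) :
    ∑ 𝔣 ∈ (idealsLE K Q).filter (fun 𝔣 => Q₁ < Ideal.absNorm 𝔣),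
        (∑ χ ∈ primChars K 𝔣, (‖S2 K χ k M U‖ + ‖S3 K χ k M U‖)) / Nat.card ((𝓞 K ⧸ 𝔣)ˣ) ≤
      cErr K * G ^ d / M ^ d *
        ((∑ 𝔟 ∈ idealsLE K U, idealVonMangoldt 𝔟 * Ideal.absNorm 𝔟) * (∑ 𝔠 ∈ idealsLE K U, (Ideal.absNorm 𝔠 : ℝ)) +
          (d * Real.log M + Real.log U + d) * ∑ 𝔟 ∈ idealsLE K U, (Ideal.absNorm 𝔟 : ℝ)) *
        ∑ 𝔣 ∈ idealsLE K Q, (Ideal.absNorm 𝔣 : ℝ) ^ 2 := by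
  have hM0 : 0 < M := by linarith
  have hcE := cErr_pos (K := K)
  obtain ⟨SΛ, hSΛ⟩ : ∃ SΛ : ℝ, SΛ = ∑ 𝔟 ∈ idealsLE K U, idealVonMangoldt 𝔟 * Ideal.absNorm 𝔟 := ⟨_, rfl⟩
  obtain ⟨SU, hSU⟩ : ∃ SU : ℝ, SU = ∑ 𝔠 ∈ idealsLE K U, (Ideal.absNorm 𝔠 : ℝ) := ⟨_, rfl⟩
  obtain ⟨Lg, hLg⟩ : ∃ Lg : ℝ, Lg = d * Real.log M + Real.log U + d := ⟨_, rfl⟩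
  rw [← hSΛ, ← hSU, ← hLg]
  have hSΛ0 : 0 ≤ SΛ := by
    rw [hSΛ]; exact Finset.sum_nonneg fun 𝔟 _ => mul_nonneg (idealVonMangoldt_nonneg _) (Nat.cast_nonneg _)
  have hSU0 : 0 ≤ SU := by rw [hSU]; exact Finset.sum_nonneg fun _ _ => Nat.cast_nonneg _
  have hLg0 : 0 ≤ Lg := by
    rw [hLg]; have := Real.log_nonneg hM; have := Real.log_nonneg hU; positivity
  obtain ⟨A, hA⟩ : ∃ A : ℝ, A = cErr K * G ^ d / M ^ d * (SΛ * SU + Lg * SU) := ⟨_, rfl⟩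
  have hA0 : 0 ≤ A := by rw [hA]; positivity
  -- per modulus
  have hper : ∀ 𝔣 ∈ (idealsLE K Q).filter (fun 𝔣 => Q₁ < Ideal.absNorm 𝔣),
      (∑ χ ∈ primChars K 𝔣, (‖S2 K χ k M U‖ + ‖S3 K χ k M U‖)) / Nat.card ((𝓞 K ⧸ 𝔣)ˣ) ≤
        A * (Ideal.absNorm 𝔣 : ℝ) ^ 2 := by
    intro 𝔣 h𝔣
    rw [Finset.mem_filter, mem_idealsLE] at h𝔣
    obtain ⟨⟨h𝔣0, -⟩, hQ₁𝔣⟩ := h𝔣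
    have h𝔣1 : 𝔣 ≠ ⊤ := ne_top_of_one_lt_absNorm (lt_of_le_of_lt hQ₁ hQ₁𝔣)
    haveI : Finite (𝓞 K ⧸ 𝔣) := Ideal.finiteQuotientOfFreeOfNeBot 𝔣 h𝔣0
    letI : Fintype (𝓞 K ⧸ 𝔣) := Fintype.ofFinite _
    have hφ : (0 : ℝ) < Nat.card ((𝓞 K ⧸ 𝔣)ˣ) := by exact_mod_cast Nat.card_pos
    have hχ : ∀ χ ∈ primChars K 𝔣, ‖S2 K χ k M U‖ + ‖S3 K χ k M U‖ ≤ A * (Ideal.absNorm 𝔣 : ℝ) ^ 2 := by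
      intro χ hχ
      have hprim := (mem_primChars h𝔣0).1 hχ
      have h2 := norm_S2_le hhi hg3 hgs hG0 hG hM0 U h𝔣0 h𝔣1 hprim
      have h3 := norm_S3_le hhi hg3 hgs hg3' hgs' hG0 hG hG' hM hU h𝔣0 h𝔣1 hprim
      rw [← hSΛ, ← hSU] at h2
      rw [← hSU, ← hLg] at h3
      refine (add_le_add h2 h3).trans (le_of_eq ?_)
      rw [hA]; ring
    calc (∑ χ ∈ primChars K 𝔣, (‖S2 K χ k M U‖ + ‖S3 K χ k M U‖)) / Nat.card ((𝓞 K ⧸ 𝔣)ˣ)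
        ≤ ((primChars K 𝔣).card * (A * (Ideal.absNorm 𝔣 : ℝ) ^ 2)) / Nat.card ((𝓞 K ⧸ 𝔣)ˣ) := by
          refine div_le_div_of_nonneg_right ?_ hφ.le
          refine (Finset.sum_le_sum hχ).trans (le_of_eq ?_)
          rw [Finset.sum_const, nsmul_eq_mul]
      _ = ((primChars K 𝔣).card / Nat.card ((𝓞 K ⧸ 𝔣)ˣ)) * (A * (Ideal.absNorm 𝔣 : ℝ) ^ 2) := by ring
      _ ≤ 1 * (A * (Ideal.absNorm 𝔣 : ℝ) ^ 2) :=
          mul_le_mul_of_nonneg_right ((div_le_one hφ).2 (card_primChars_le h𝔣0)) (by positivity)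
      _ = _ := one_mul _
  calc ∑ 𝔣 ∈ (idealsLE K Q).filter (fun 𝔣 => Q₁ < Ideal.absNorm 𝔣),
        (∑ χ ∈ primChars K 𝔣, (‖S2 K χ k M U‖ + ‖S3 K χ k M U‖)) / Nat.card ((𝓞 K ⧸ 𝔣)ˣ)
      ≤ ∑ 𝔣 ∈ (idealsLE K Q).filter (fun 𝔣 => Q₁ < Ideal.absNorm 𝔣), A * (Ideal.absNorm 𝔣 : ℝ) ^ 2 :=
        Finset.sum_le_sum hper
    _ ≤ ∑ 𝔣 ∈ idealsLE K Q, A * (Ideal.absNorm 𝔣 : ℝ) ^ 2 :=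
        Finset.sum_le_sum_of_subset_of_nonneg (Finset.filter_subset _ _) fun _ _ _ => by positivity
    _ = _ := by rw [← Finset.mul_sum, hA]

/-! ## Crude evaluations of the auxiliary sums -/

omit [IsTotallyReal K] in
/-- `∑_{N𝔠 ≤ U} N𝔠 ≤ U · #idealsLE U`. [folklore] -/
theorem sum_absNorm_le (U : ℝ) :
    ∑ 𝔠 ∈ idealsLE K U, (Ideal.absNorm 𝔠 : ℝ) ≤ U * (idealsLE K U).card := by
  calc ∑ 𝔠 ∈ idealsLE K U, (Ideal.absNorm 𝔠 : ℝ) ≤ ∑ _𝔠 ∈ idealsLE K U, U :=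
        Finset.sum_le_sum fun 𝔠 h => (mem_idealsLE.1 h).2
    _ = U * (idealsLE K U).card := by rw [Finset.sum_const, nsmul_eq_mul, mul_comm]

omit [IsTotallyReal K] in
/-- `∑_{N𝔟 ≤ U} Λ(𝔟) N𝔟 ≤ U log U · #idealsLE U` (`U ≥ 1`). [folklore] -/
theorem sum_vonMangoldt_mul_absNorm_le {U : ℝ} (hU : 1 ≤ U) :
    ∑ 𝔟 ∈ idealsLE K U, idealVonMangoldt 𝔟 * Ideal.absNorm 𝔟 ≤ U * Real.log U * (idealsLE K U).card := by
  have hlogU := Real.log_nonneg hU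
  calc ∑ 𝔟 ∈ idealsLE K U, idealVonMangoldt 𝔟 * Ideal.absNorm 𝔟 ≤ ∑ _𝔟 ∈ idealsLE K U, Real.log U * U := by
        refine Finset.sum_le_sum fun 𝔟 h𝔟 => ?_
        obtain ⟨h0, hle⟩ := mem_idealsLE.1 h𝔟
        have hN := absNorm_pos_of_ne_bot h0
        have h1 : idealVonMangoldt 𝔟 ≤ Real.log U :=
          (idealVonMangoldt_le_log h0).trans (Real.log_le_log hN hle)
        exact mul_le_mul h1 hle hN.le hlogU
    _ = U * Real.log U * (idealsLE K U).card := by rw [Finset.sum_const, nsmul_eq_mul]; ring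

omit [IsTotallyReal K] in
/-- `∑_{N𝔣 ≤ Q} N𝔣² ≤ Q² · #idealsLE Q` (`Q ≥ 0`). [folklore] -/
theorem sum_absNorm_sq_le (Q : ℝ) :
    ∑ 𝔣 ∈ idealsLE K Q, (Ideal.absNorm 𝔣 : ℝ) ^ 2 ≤ Q ^ 2 * (idealsLE K Q).card := by
  calc ∑ 𝔣 ∈ idealsLE K Q, (Ideal.absNorm 𝔣 : ℝ) ^ 2 ≤ ∑ _𝔣 ∈ idealsLE K Q, Q ^ 2 :=
        Finset.sum_le_sum fun 𝔣 h => pow_le_pow_left₀ (Nat.cast_nonneg _) (mem_idealsLE.1 h).2 2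
    _ = Q ^ 2 * (idealsLE K Q).card := by rw [Finset.sum_const, nsmul_eq_mul, mul_comm]

end Literature.NumberTheory.Sieve.SmoothTypeOne
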